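import Summits.ResolutionOfSingularities.ResolutionOfSingularities.Theorems.PurelyInseparableDim4PiPlateauNoRise
import Summits.ResolutionOfSingularities.ResolutionOfSingularities.Theorems.PurelyInseparableDim4PiPlateauPthPower
import HarnessLib

/-!
# THE PLATEAU LAW Π — `piPlateau_holds : PiPlateau p e` (cell `res-dim4-pi`, CARD I-5-5)

[OURS · counted 0]  Nothing here is a statement about resolution of singularities in dimension ≥ 4 /
characteristic `p`, which is NOT proved; Π is a persistence / no-rise law for ONE point letter under POINT
blow-ups (desk MODE 0), not a decrease at jumps (standing no-go (C) untouched).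

This module closes res-dim4-idea-5's typed target `PIDim4.PiPlateau p e` (`…PiPlateauStatement`, p658733;
consolidated write-up `PiPlateau-consolidated.md` ecef900b4de1a97c, pen proof idea-5 / crit-2 / crit-3; typing
blueprint d8a3f498d0e42ada) BY NAME, for every prime `p` and every `e`:

* `piEdge_holds` — on every MODE-0 edge (`t j = 0`) from a `q`-fold `V_q`-active state with non-zero child,
  `d′ ≤ d` (`residualOrder_step_le`, module `…PiPlateauNoRise`) and `d′ = d ⇒ V_q′ = 1`.  The second half: at
  `d′ = d` the key class monomial `x^{cls A} x^k` is initial in the child and at the top of the budget; if no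
  initial monomial of the child had a non-exceptional variable with exponent `≢ 0 (mod q)`, then every class
  monomial survives, every monomial of `G_{cls A}` has `T`-degree `≥ κ` and those of degree `κ` are `q`-th
  powers; `i` translated ⇒ Step (α) (`HasseEuler.step_alpha_core`) gives `q ∣ A_i`; `i` untranslated `≠ j` ⇒
  the key monomial itself is a witness; `i = j` ⇒ `isPthPowerExponent_and_dvd_of_layer` (`Q_A ∈ K[x^q]`,
  `q ∣ κ = |β_A| + A_j`) gives `q ∣ A_j` — contradiction each time;
* **`piPlateau_holds (p e : ℕ) [Fact p.Prime] : PiPlateau p e`.**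
* corollaries: `pi_of_isVActive` (the hypothesis-minimal form: cleanness of the parent and `F′ ≠ 0` are idle —
  the child of a `V_q`-active `q`-fold state is never zero) and `one_le_residualOrder_of_isVActive` (`d ≥ 1` on
  `V_q`-active states, so `ω = d − [V_q]` is a natural number).

Cleanness of the parent (a hypothesis of `PiEdge`) is not used.  Typed and proved by res-dim4-typ-1 on
res-dim4-idea-5's blueprint; bricks `…HasseEuler`, `…HasseEulerLadder`, `…HasseEulerAlpha`, `…PiPlateauClasses`,
`…PiPlateauBrickData`, `…PiPlateauNoRise`, `…PiPlateauPthPower`.  Supports stmt-ResolutionOfSingularities-16155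
(helper).  bears_on: LADDER-RESOLUTION:D157-DOOR2 (res-dim4-pi · I-5-5 Π).
-/

set_option linter.dupNamespace false -- mandated namespace of this single-conjunct summit

namespace Summit.ResolutionOfSingularities.ResolutionOfSingularities.Theorems.PIDim4

namespace Plateau

open MvPolynomial Finset
open Literature.AlgebraicGeometry.Resolution
open Literature.AlgebraicGeometry.Resolution.Hauser2010
open Literature.AlgebraicGeometry.Resolution.CentreBlowup
open Literature.Barriers.ResolutionOfSingularities
open Literature.Barriers.ResolutionOfSingularities.HauserPerlega
open Summit.ResolutionOfSingularities.ResolutionOfSingularities.Theorems.Rescue.BedCylinderTransport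
  (residualOrder_eq_ordZero_sub forall_le_degree_of_ordZero_eq)

variable {σ : Type*} [Fintype σ] [DecidableEq σ] {K : Type*} [Field K] [DecidableEq K]

/-- Translated variables are not exceptional after the step (`Δ′ = {j} ∪ {u ∈ Δ : t u = 0}`, `t j = 0`).
[folklore] -/
theorem not_mem_exc_step_of_ne_zero (q : ℕ) {j : σ} {t : σ → K} (ht : t j = 0) (s : CState σ K) {m : σ}
    (hm : t m ≠ 0) : m ∉ (CentreBlowup.step q Finset.univ j t s).exc := by
  show m ∉ insert j (s.exc.filter fun i => t i = 0)
  rw [Finset.mem_insert, Finset.mem_filter]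
  rintro (rfl | ⟨-, h⟩)
  · exact hm ht
  · exact hm h

/-- A non-exceptional untranslated variable `≠ j` stays non-exceptional. [folklore] -/
theorem not_mem_exc_step_of_not_mem (q : ℕ) {j : σ} (t : σ → K) (s : CState σ K) {m : σ} (hm : m ∉ s.exc)
    (hmj : m ≠ j) : m ∉ (CentreBlowup.step q Finset.univ j t s).exc := by
  show m ∉ insert j (s.exc.filter fun i => t i = 0)
  rw [Finset.mem_insert, Finset.mem_filter]
  rintro (rfl | ⟨h, -⟩)
  · exact hmj rfl
  · exact hm h

/-- **Π ON ONE EDGE, hypothesis-minimal form**: on a MODE-0 edge (`t j = 0`) from a `q`-fold (`q = p^e`)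
`V_q`-active state — clean or not — the child is NON-ZERO (the key class monomial survives cleaning; so the
hypothesis `F′ ≠ 0` of `PiEdge` is automatic, crit-2 K-Π-STATEMENT (n2)), `d′ ≤ d`, and `d′ = d ⇒ V_q′ = 1`.
Every field of characteristic `p`, any number of variables. [folklore] -/
theorem pi_of_isVActive (p : ℕ) [Fact p.Prime] [CharP K p] (e : ℕ) (s : CState σ K) (j : σ) (t : σ → K)
    (ht : t j = 0) (hq : ((p ^ e : ℕ) : ℕ∞) ≤ ordZero s.F) (hV : IsVActive (p ^ e) s.exc s.F) :
    (CentreBlowup.step (p ^ e) Finset.univ j t s).F ≠ 0 ∧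
      residualOrder (CentreBlowup.step (p ^ e) Finset.univ j t s).exc (CentreBlowup.step (p ^ e) Finset.univ j t s).F ≤
          residualOrder s.exc s.F ∧
        (residualOrder (CentreBlowup.step (p ^ e) Finset.univ j t s).exc
            (CentreBlowup.step (p ^ e) Finset.univ j t s).F = residualOrder s.exc s.F →
          IsVActive (p ^ e) (CentreBlowup.step (p ^ e) Finset.univ j t s).exc
            (CentreBlowup.step (p ^ e) Finset.univ j t s).F) := by
  obtain ⟨A, hA, hAdeg, i, hiΔ, hqi⟩ := hV
  obtain ⟨o, ho, hqo, hAo, k, hk, hkdeg, hnp, hD, hbud⟩ :=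
    exists_support_step_budget p e s j t ht hq hA hAdeg hiΔ hqi
  have hne : (CentreBlowup.step (p ^ e) Finset.univ j t s).F ≠ 0 := MvPolynomial.support_nonempty.mp ⟨_, hD⟩
  refine ⟨hne, residualOrder_step_le p e s j t ht hq ⟨A, hA, hAdeg, i, hiΔ, hqi⟩ hne, fun heq => ?_⟩
  obtain ⟨hDo', hbudeq⟩ := degree_eq_of_residualOrder_eq p e s j t ht ho hne heq hD hbud
  -- notation-free bookkeeping facts
  have hob : ∀ b ∈ s.F.support, o ≤ b.degree := forall_le_degree_of_ordZero_eq ho le_rfl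
  have hqb : ∀ b ∈ s.F.support, p ^ e ≤ b.degree := fun b hb => hqo.trans (hob b hb)
  have hr : ∀ b ∈ s.F.support, exceptionalExp s.exc s.F ≤ b :=
    fun b hb => exceptionalExp_le_exponent_of_mem_support s.exc hb
  have hrA := hr A hA
  have hri : exceptionalExp s.exc s.F i = 0 := exceptionalExp_apply_eq_zero_of_not_mem s.F hiΔ
  have hku : uPart t k = 0 := uPart_eq_zero_of_mem_support_classPoly (p ^ e) j t s.F hk
  have htT := ne_zero_of_mem_support_tPart t (exceptionalExp s.exc s.F)
  have hG := classPoly_eq_translate_mul_brickPoly (p ^ e) j t s.F hr A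
  have hβA : tPart t A - tPart t (exceptionalExp s.exc s.F) ∈ (brickPoly (p ^ e) j t s.F (exceptionalExp s.exc s.F) A).support :=
    mem_support_brickPoly (p ^ e) ht hqb hr hA rfl
  have hTT : (tPart t A - tPart t (exceptionalExp s.exc s.F)).degree + (tPart t (exceptionalExp s.exc s.F)).degree =
      (tPart t A).degree := by
    rw [← map_add, tsub_add_cancel_of_le (tPart_mono t hrA)]
  have hdegQ : ∀ β ∈ (brickPoly (p ^ e) j t s.F (exceptionalExp s.exc s.F) A).support,
      β.degree + (tPart t (exceptionalExp s.exc s.F)).degree + exceptionalExp s.exc s.F j ≤ (tPart t A).degree + A j :=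
    fun β hβ => degree_add_le_of_mem_support_brickPoly (p ^ e) ht hqb hr hA hβ
  -- the key monomial sits at the top of the budget
  have hktop : k.degree + (tPart t (exceptionalExp s.exc s.F)).degree + exceptionalExp s.exc s.F j =
      (tPart t A).degree + A j := by
    have h1 := degree_cls_add (p ^ e) ht (hAo.symm ▸ hqo : p ^ e ≤ A.degree)
    have h2 := degree_eq_uPart_add_tPart t A
    have h3 := degree_eq_uPart_add_tPart t (exceptionalExp s.exc s.F)
    have h4 := degree_rho_add (p ^ e) ht (exceptionalExp s.exc s.F) o
    have h5 : exceptionalExp s.exc s.F j ≤ A j := hrA j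
    have h6 := apply_le_degree_uPart ht A
    rw [map_add] at hbudeq
    omega
  -- degree of the initial class monomials
  have hDdeg : ∀ k' : σ →₀ ℕ, k'.degree = k.degree →
      (((cls (p ^ e) j t A + k').degree : ℕ) : ℕ∞) = ordZero (CentreBlowup.step (p ^ e) Finset.univ j t s).F := by
    intro k' hk'
    rw [← hDo', map_add, map_add, hk']
  by_contra hV'
  apply hV'
  -- suppose no initial monomial of the child is a `V_q`-witness
  by_contra hno
  simp only [IsVActive, not_exists, not_and] at hno
  -- hno : ∀ a ∈ supp F', |a| = ord → ∀ m, m ∉ Δ' → q ∣ a m   (shape after simp)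
  have hno' : ∀ a ∈ (CentreBlowup.step (p ^ e) Finset.univ j t s).F.support,
      (((a.degree : ℕ)) : ℕ∞) = ordZero (CentreBlowup.step (p ^ e) Finset.univ j t s).F →
        ∀ m, m ∉ (CentreBlowup.step (p ^ e) Finset.univ j t s).exc → p ^ e ∣ a m := by
    intro a ha hdeg m hm
    by_contra h
    exact hno a ha hdeg m hm h
  -- (1) the key monomial's `T`-part is a `q`-th power
  have hkT : ∀ m, t m ≠ 0 → p ^ e ∣ k m := by
    intro m hm
    have := hno' _ hD (hDdeg k rfl) m (not_mem_exc_step_of_ne_zero (p ^ e) ht s hm)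
    rwa [cls_add_apply_of_ne_zero (p ^ e) ht A k hm] at this
  -- (2) hence the class exponent `cls A` is NOT a `q`-th power: every class monomial survives cleaning
  have hsurv : ∀ k' : σ →₀ ℕ, uPart t k' = 0 → ¬ IsPthPowerExponent (p ^ e) (cls (p ^ e) j t A + k') := by
    intro k' hk' hP
    apply hnp
    rw [isPthPowerExponent_iff] at hP ⊢
    intro m
    by_cases hm : t m = 0
    · have := hP m
      rw [cls_add_apply_of_eq_zero (p ^ e) A hk' hm] at this
      rwa [cls_add_apply_of_eq_zero (p ^ e) A hku hm]
    · rw [cls_add_apply_of_ne_zero (p ^ e) ht A k hm]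
      exact hkT m hm
  -- (3) so every monomial of `G_{cls A}` has `T`-degree `≥ |k|`, and those of degree `|k|` are `q`-th powers
  have hord : ∀ k' ∈ (classPoly (p ^ e) j t s.F (cls (p ^ e) j t A)).support, k.degree ≤ k'.degree := by
    intro k' hk'
    have hk'u := uPart_eq_zero_of_mem_support_classPoly (p ^ e) j t s.F hk'
    have hD' : cls (p ^ e) j t A + k' ∈ (CentreBlowup.step (p ^ e) Finset.univ j t s).F.support := by
      rw [MvPolynomial.mem_support_iff, coeff_cls_add_step (p ^ e) ht s A hk'u, if_neg (hsurv k' hk'u)]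
      exact MvPolynomial.mem_support_iff.mp hk'
    have h1 := ordZero_le_degree_of_mem_support hD'
    rw [← hDo', Nat.cast_le, map_add, map_add] at h1
    omega
  have hpth : ∀ k' ∈ (classPoly (p ^ e) j t s.F (cls (p ^ e) j t A)).support, k'.degree ≤ k.degree →
      IsPthPowerExponent (p ^ e) k' := by
    intro k' hk' hle m hm
    have hk'u := uPart_eq_zero_of_mem_support_classPoly (p ^ e) j t s.F hk'
    have hD' : cls (p ^ e) j t A + k' ∈ (CentreBlowup.step (p ^ e) Finset.univ j t s).F.support := by
      rw [MvPolynomial.mem_support_iff, coeff_cls_add_step (p ^ e) ht s A hk'u, if_neg (hsurv k' hk'u)]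
      exact MvPolynomial.mem_support_iff.mp hk'
    have htm : t m ≠ 0 := by
      intro h0
      exact (Finsupp.mem_support_iff.mp hm) (apply_eq_zero_of_uPart_eq_zero t hk'u h0)
    have := hno' _ hD' (hDdeg k' (le_antisymm hle (hord k' hk'))) m (not_mem_exc_step_of_ne_zero (p ^ e) ht s htm)
    rwa [cls_add_apply_of_ne_zero (p ^ e) ht A k' htm] at this
  -- (4) case analysis on the witness variable
  by_cases hti : t i = 0
  · by_cases hij : i = j
    · -- `i = j`, off R: `Q_A ∈ K[x^q]` and `q ∣ κ`
      subst hij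
      have hQ0 : brickPoly (p ^ e) i t s.F (exceptionalExp s.exc s.F) A ≠ 0 :=
        MvPolynomial.support_nonempty.mp ⟨_, hβA⟩
      obtain ⟨hQpth, hκ⟩ := isPthPowerExponent_and_dvd_of_layer p e t (tPart t (exceptionalExp s.exc s.F)) htT
        _ hQ0 k.degree (fun β hβ => by have := hdegQ β hβ; omega) (by rw [← hG]; exact hord)
        (by rw [← hG]; exact hpth)
      have h1 := dvd_degree_of_isPthPowerExponent _ (hQpth _ hβA)
      apply hqi
      have h2 : A i = k.degree - (tPart t A - tPart t (exceptionalExp s.exc s.F)).degree := by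
        rw [hri] at hktop; omega
      rw [h2]
      exact Nat.dvd_sub hκ h1
    · -- `i` untranslated, `≠ j`, `i ∉ Δ`: the key monomial is itself a witness at `x_i`
      have := hno' _ hD (hDdeg k rfl) i (not_mem_exc_step_of_not_mem (p ^ e) t s hiΔ hij)
      rw [cls_add_apply_of_eq_zero (p ^ e) A hku hti, if_neg hij] at this
      exact hqi this
  · -- `i` translated: Step (α) with hypothesis H at `κ = |k|`
    have hi' : tPart t (exceptionalExp s.exc s.F) i = 0 := by rw [tPart_apply, if_pos hti, hri]
    have hP : PointBlowup.translate t (monomial (tPart t (exceptionalExp s.exc s.F)) (1 : K) *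
        ∑ β ∈ (brickPoly (p ^ e) j t s.F (exceptionalExp s.exc s.F) A).support,
          monomial β (coeff β (brickPoly (p ^ e) j t s.F (exceptionalExp s.exc s.F) A))) =
        classPoly (p ^ e) j t s.F (cls (p ^ e) j t A) := by
      rw [← brickPoly_eq_sum_support, ← hG]
    have key := HasseEuler.step_alpha_core p t (tPart t (exceptionalExp s.exc s.F)) htT hi'
      (brickPoly (p ^ e) j t s.F (exceptionalExp s.exc s.F) A).support
      (fun β => coeff β (brickPoly (p ^ e) j t s.F (exceptionalExp s.exc s.F) A))
      (coeff_ne_zero_of_mem_support_brickPoly (p ^ e) j t s.F (exceptionalExp s.exc s.F) A) k.degree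
      (fun β hβ => by have := hdegQ β hβ; omega)
      (fun d hd hdd m => by
        rw [hP] at hd
        exact (isPthPowerExponent_iff _ d).mp (hpth d hd hdd) m)
    have h1 := key _ hβA
    rw [Finsupp.tsub_apply, tPart_apply, tPart_apply, if_pos hti, if_pos hti, hri, Nat.sub_zero] at h1
    exact hqi h1

/-- **Π ON ONE EDGE** — both halves of `Plateau.PiEdge` (its cleanness and `F′ ≠ 0` hypotheses are idle).
[folklore] -/
theorem piEdge_holds (p : ℕ) [Fact p.Prime] [CharP K p] (e : ℕ) (s : CState σ K) (j : σ) (t : σ → K) :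
    PiEdge (p ^ e) s j t :=
  fun ht _ hq hV _ => (pi_of_isVActive p e s j t ht hq hV).2

omit [DecidableEq K] in
/-- **A `V_q`-active state has residual order `d ≥ 1`**: if `d = 0` the only initial monomial is the
exceptional monomial `x^r`, whose exponents off `Δ` vanish (blueprint §F, the letter `ω = d − [V_q] ≥ 0`).
[folklore] -/
theorem one_le_residualOrder_of_isVActive (q : ℕ) (Δ : Finset σ) (F : MvPolynomial σ K)
    (hV : IsVActive q Δ F) : (1 : ℕ∞) ≤ residualOrder Δ F := by
  obtain ⟨A, hA, hAdeg, i, hiΔ, hqi⟩ := hV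
  have hF0 : F ≠ 0 := MvPolynomial.support_nonempty.mp ⟨A, hA⟩
  obtain ⟨o, ho⟩ := exists_ordZero_eq_natCast hF0
  have hAo : A.degree = o := by rw [ho] at hAdeg; exact_mod_cast hAdeg
  obtain ⟨hrdeg, hd⟩ := residualOrder_eq_ordZero_sub Δ ho
  have hrA : exceptionalExp Δ F ≤ A := exceptionalExp_le_exponent_of_mem_support Δ hA
  have hri : exceptionalExp Δ F i = 0 := exceptionalExp_apply_eq_zero_of_not_mem F hiΔ
  rw [hd, show (1 : ℕ∞) = ((1 : ℕ) : ℕ∞) from rfl, Nat.cast_le]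
  by_contra hlt
  rcases hrA.lt_or_eq with h | h
  · have := PointBlowup.degree_lt_degree_of_lt h
    omega
  · apply hqi
    rw [← h, hri]
    exact dvd_zero _

/-- **THE PLATEAU LAW Π HOLDS** (res-dim4-idea-5 CARD I-5-5; pen proof idea-5 / crit-2 / crit-3; statement
`PIDim4.PiPlateau`): for every prime `p` and every `e`, `q = p^e`, over every field of characteristic `p`, in any
number of variables, on every MODE-0 edge from a clean `q`-fold `V_q`-active state with non-zero child:
`d′ ≤ d`, and `d′ = d ⇒ V_q′ = 1`.  OURS · instrument about one point letter; nothing here proves resolution of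
singularities in dim ≥ 4 / char `p`. [folklore] -/
theorem piPlateau_holds (p e : ℕ) [Fact p.Prime] : PiPlateau p e := by
  intro σ _ _ K _ _ _ s j t
  exact piEdge_holds p e s j t

end Plateau

end Summit.ResolutionOfSingularities.ResolutionOfSingularities.Theorems.PIDim4
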